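import Summits.BirchSwinnertonDyer.BirchSwinnertonDyer.Theorems.ResidualThetaTransportAtTwoRlfLayerIsoRealization
import Summits.BirchSwinnertonDyer.BirchSwinnertonDyer.Theorems.ResidualThetaTransportAtTwoRlfLayerKummerCupZero
import Summits.BirchSwinnertonDyer.BirchSwinnertonDyer.Theorems.ResidualThetaTransportAtTwoRlfCorSurj
import Summits.BirchSwinnertonDyer.BirchSwinnertonDyer.Theorems.ResidualThetaTransportAtTwoPlusDualThetaExtraction
import Literature.NumberTheory.GaloisCohomology.ArchimedeanInvariantMap
import HarnessLib

/-!
# Route `ResidualThetaTransportAtTwo` (RTT P6, item stmt-BirchSwinnertonDyer-23110, road T): LAYER-ISO ASSEMBLED — B. D. Kim's Prop. 3.15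
# at `p = 2` for the untwisted layer-`J` classes of `E[2^J]|` with `A`-witnesses, `A = ⋃ₙ E⁺(ℚ_{v,n})` (the `hLI` binder of
# `TwistedLocalKummer.iso_of_layerIso` VERBATIM), from the dictionary + (d′) + ISO-1c + the θ-EXTRACTION

Lead seat `bsd-wall-tp2-p2x` g13 (cell `bsd-wall`), line `hplusdual` on 23110. THEOREMS ONLY; closes nothing by itself (the stub `stub_iso` follows from
`layerIso` and w2's `iso_of_layerIso`; the item still needs the two PRINT stubs); BSD is NOT proved by any of this.
-/

-- the Theorems namespace of this sub repeats the summit name by design (D-0017 nested layout)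
set_option linter.dupNamespace false

noncomputable section

open scoped Classical NumberField
open CategoryTheory Function Field NumberField IsDedekindDomain

namespace Summit.BirchSwinnertonDyer.BirchSwinnertonDyer.Theorems.SignedEC.LayerIsoAssembly

open Literature.NumberTheory.EllipticCurves Literature.NumberTheory.GaloisRepresentations WeierstrassCurve ZpExtension
  Literature.NumberTheory.EllipticCurves.Kobayashi2003 Literature.NumberTheory.EllipticCurves.Sprung2012 SignedKatoOffTwo
  TwistedLocalKummer LayerWitnessDict Literature.NumberTheory.EllipticCurves.IwasawaDual Literature.NumberTheory.GaloisCohomology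
  Summit.BirchSwinnertonDyer.Rank1Residual.Additive
open scoped ContRepresentation

universe u

variable (W : WeierstrassCurve ℚ) [W.IsElliptic] [W.IsGloballyMinimal]

omit [W.IsElliptic] [W.IsGloballyMinimal] in
/-- `ω_n(φ − 1) s = φ^{2^n} s − s` (`ω_n = (1+T)^{2^n} − 1`). [cite: Pollack2003, Thm. 6.17] -/
theorem aeval_cyclotomicOmega_two_apply {S : Type*} [AddCommGroup S] (φ : AddMonoid.End S) (n : ℕ) (s : S) :
    Polynomial.aeval (φ - 1) (cyclotomicOmega 2 n) s = (φ ^ 2 ^ n) s - s := by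
  simp only [cyclotomicOmega, map_sub, map_pow, map_add, Polynomial.aeval_X, map_one, sub_add_cancel]
  rfl

/-- THE local invariant map is injective (local Tate duality, `canonical_isPerfect`). [cite: MilneADT2006, Ch. I, Cor. 2.3] -/
theorem invAt_injective (N : ℕ) [NeZero N] (v : HeightOneSpectrum (𝓞 ℚ)) : Function.Injective (LayerPairing.invAt N v) :=
  (LocalInvariants.canonical_isPerfect (K := ℚ) (n := N) v).1.injective

/-- **LAYER-ISO (B. D. Kim's Prop. 3.15 at `p = 2` for witness classes).** For `W/ℚ` globally minimal with good supersingular reduction at `2`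
and `a₂(W) = 0`, `κ` cyclotomic: for every `J`, alternating non-degenerate equivariant Weil datum `e` on `E[2^J]`, `v ∋ 2`, and any two
continuous `U_J`-cocycles `f₀, g₀` of `E[2^J]|` with `A`-witnesses (`A = ⋃ₙ E⁺(ℚ_{v,n})`), `Sh_J[f₀] ∪_{Σe} Sh_J[g₀] = 0` — the `hLI` binder of
`TwistedLocalKummer.iso_of_layerIso` VERBATIM. Proof: realize `A ⊗ ℚ₂/ℤ₂` by the divisible hull `S` (`exists_divisibleHull`) with its canonical
dual pair, free of rank one by (R1)@2 (`PlusDualTwo.nonempty_linearEquiv_iwasawaAlgebra_two`); on each layer `S[2^J, φ^{2^n} = 1]` the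
DICTIONARY (`exists_witness_of_mem_layer` / `oneCocycleClass_eq_of_point_eq` / `point_mem_layer_of_witness`) identifies points with witnessed
classes of `H¹(U_n, E[2^J]|)`, and `B_n(s,t) = inv_v(Sh_n · ∪_{Σe} Sh_n ·)` is bi-additive, `φ`-invariant ((D6)), compatible with
`N_{n+1/n} = 1 + φ^{2^n}` ((D5) + the norm step) and vanishes on the honest image `ω̃⁻_{2m}(φ−1)·S[2^J, ω_{2m}]` ((d′) + ISO-1c); the
θ-EXTRACTION (`PlusDual.forall_layerForm_eq_zero_two`) gives `B_n = 0` on every layer; injectivity of `inv_v` concludes.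
[cite: BDKim2007, Prop. 3.15, Prop. 3.17, Prop. 3.18] [cite: Kobayashi2003, Thm. 6.2, Prop. 8.12, (8.23)] [cite: MilneADT2006, Ch. I, Cor. 2.3] -/
theorem layerIso (hss : Rank1Residual.GoodSS W 2) (ha : W.frobeniusTrace 2 = 0) {κ : ZpExtension ℚ 2} (hκ : κ.IsCyclotomic) :
    ∀ (J : ℕ) (e : W.geomTorsion ((2 ^ J : ℕ) : ℤ) → W.geomTorsion ((2 ^ J : ℕ) : ℤ) → AlgebraicClosure ℚ)
      (hμ : ∀ S T, e S T ^ (2 ^ J) = 1) (hadd₁ : ∀ S₁ S₂ T, e (S₁ + S₂) T = e S₁ T * e S₂ T)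
      (hadd₂ : ∀ S T₁ T₂, e S (T₁ + T₂) = e S T₁ * e S T₂)
      (hgal : ∀ (σ : absoluteGaloisGroup ℚ) (S T : W.geomTorsion ((2 ^ J : ℕ) : ℤ)), σ • e S T = e (σ • S) (σ • T)),
      (∀ T, e T T = 1) → (∀ T, (∀ S, e S T = 1) → T = 0) → ∀ [NeZero (2 ^ J)],
      ∀ (v : HeightOneSpectrum (𝓞 ℚ)) [CompactSpace (absoluteGaloisGroup (v.adicCompletion ℚ))], ((2 : ℕ) : 𝓞 ℚ) ∈ v.asIdeal →
      ∀ (f₀ g₀ : contOneCocycles (subgroupRep (LayerPairing.torsionLocalRep W (2 ^ J) v) (LayerPairing.layerGroup κ v J)))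
        (Qf Qg : localPoints W (v.adicCompletion ℚ)) (kf kg : ℕ),
        2 ^ kf • Qf ∈ (⨆ n : ℕ, signedLocalPoints κ (v.adicCompletion ℚ) W 1 n) →
        (∀ (τ : absoluteGaloisGroup (v.adicCompletion ℚ)) (hτ : τ ∈ localSubgroup κ.kerSubgroup (v.adicCompletion ℚ)),
          pointsMap W (v.adicCompletion ℚ) ((f₀.1 ⟨τ, kerLocal_le_layerGroup κ v J hτ⟩ : W.geomTorsion ((2 ^ J : ℕ) : ℤ)) :
            W.geomPoints) = τ • Qf - Qf) →
        2 ^ kg • Qg ∈ (⨆ n : ℕ, signedLocalPoints κ (v.adicCompletion ℚ) W 1 n) →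
        (∀ (τ : absoluteGaloisGroup (v.adicCompletion ℚ)) (hτ : τ ∈ localSubgroup κ.kerSubgroup (v.adicCompletion ℚ)),
          pointsMap W (v.adicCompletion ℚ) ((g₀.1 ⟨τ, kerLocal_le_layerGroup κ v J hτ⟩ : W.geomTorsion ((2 ^ J : ℕ) : ℤ)) :
            W.geomPoints) = τ • Qg - Qg) →
        (LayerPairing.layerSumPairing W (2 ^ J) e hμ hadd₁ hadd₂ hgal κ v J).cupProduct
          (LayerPairing.layerShapiro W (2 ^ J) κ v J (oneCocycleClass _ f₀))
          (LayerPairing.layerShapiro W (2 ^ J) κ v J (oneCocycleClass _ g₀)) = 0 := by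
  intro J e hμ hadd₁ hadd₂ hgal halt _hnondeg _ v _ hv2 f₀ g₀ Qf Qg kf kg hkQf hf₀ hkQg hg₀
  haveI : Fact (Nat.Prime 2) := ⟨Nat.prime_two⟩
  have hv : (2 : 𝓞 ℚ) ∈ v.asIdeal := by exact_mod_cast hv2
  -- a local lift of the topological generator
  obtain ⟨g, hg⟩ := ZpExtension.IsCyclotomic.exists_isTopGenerator_resGalOfEmb_adicCompletion hκ v hv
  set ι₀ := closureEmb (K := ℚ) (v.adicCompletion ℚ) with hι₀
  let G := absoluteGaloisGroup (v.adicCompletion ℚ)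
  let Pt := localPoints W (v.adicCompletion ℚ)
  set A : AddSubgroup Pt := ⨆ i, signedLocalPoints κ (v.adicCompletion ℚ) W 1 i with hAdef
  have hγA : ∀ x ∈ A, g • x ∈ A := fun x hx ↦ PlusDualTwo.smul_mem_iSup_signedLocalPoints W κ v g hx
  have hAtower : A ≤ Sprung2012.localTowerPointsOfEmb κ ι₀ W := PlusDualTwo.iSup_signedLocalPoints_le_localTowerPointsOfEmb W κ v
  have hA2 : ∀ x : A, 2 • x = 0 → x = 0 := fun x h2 ↦ Subtype.ext
    (SSFlatEC.eq_zero_of_mem_localTowerPointsOfEmb_of_two_nsmul W hss κ (by exact_mod_cast hv) ι₀ (hAtower x.2)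
      (by rw [← AddSubgroup.coe_nsmul, h2, AddSubgroup.coe_zero]))
  -- ### the realization `S = A[1/2]/A` of `A ⊗ ℚ₂/ℤ₂`
  let γ : AddMonoid.End Pt := DistribSMul.toAddMonoidHom Pt g
  have hγ : ∀ x, γ x = g • x := fun _ ↦ rfl
  let γA : A →+ A := ((γ : Pt →+ Pt).comp A.subtype).codRestrict A fun x ↦ hγA x x.2
  obtain ⟨S, _, φ₀, ι, h0, hsucc, hsurj, hker0, hequiv0⟩ := ResidualThetaLayer.PlusDual.exists_divisibleHull (p := 2) A hA2 γA
  -- the endomorphism as an element of the ring `AddMonoid.End S`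
  let φ : AddMonoid.End S := φ₀
  have hker : ∀ (k : ℕ) (x : A), ι k x = 0 → ∃ w : A, (x : Pt) = 2 ^ k • (w : Pt) :=
    fun k x hx ↦ by obtain ⟨w, hw⟩ := hker0 k x hx; exact ⟨w, by rw [hw, AddSubgroup.coe_nsmul]⟩
  have hequiv : ∀ (k : ℕ) (x : A), φ (ι k x) = ι k ⟨g • (x : Pt), hγA x x.2⟩ := by
    intro k x
    rw [show φ (ι k x) = φ₀ (ι k x) from rfl, hequiv0]
    rfl
  have htor : ∀ (k : ℕ) (x : A), 2 ^ k • ι k x = 0 := ResidualThetaLayer.PlusDual.pow_nsmul_iota_eq_zero _ ι h0 hsucc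
  -- ### the canonical dual pair `(Hom(S, ℚ/ℤ), id)` and (R1)@2
  have hloc : IsLocNil 2 (φ - 1) := by
    refine ⟨fun s ↦ ?_, fun s ↦ ?_⟩
    · obtain ⟨k, x, rfl⟩ := hsurj s
      exact ⟨k, htor k x⟩
    · obtain ⟨k, x, rfl⟩ := hsurj s
      obtain ⟨m, hxm⟩ := (AddSubgroup.mem_iSup_of_directed (signedLocalPointsOfEmb_mono κ ι₀ W 1).directed_le).1 x.2
      have hfix : (φ ^ 2 ^ m) (ι k x) = ι k x := by
        rw [pow_apply_iota W κ v ι h0 hsucc hker hequiv]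
        congr 1
        apply Subtype.ext
        change g ^ (2 ^ m) • (x : Pt) = x
        simpa using Sprung2012.pow_mul_smul_of_mem_localLayerPointsOfEmb κ ι₀ W hg
          (((mem_signedLocalPointsOfEmb_iff κ ι₀ W 1 m _).1 hxm).1) 1
      exact ⟨k * 2 ^ m, pow_mul_prime_pow_apply_eq_zero Nat.prime_two _ m hfix (htor k x)⟩
  letI : Module (PowerSeries ℤ_[2]) (S →+ AddCircle (1 : ℚ)) := hloc.module
  have hpair : IsDualPair 2 (φ - 1) (AddMonoidHom.id (S →+ AddCircle (1 : ℚ))) :=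
    { bijective := Function.bijective_id
      T_smul := fun x s ↦ hloc.smulFun_X_apply x s
      C_smul := fun c x s k hk ↦ hloc.smulFun_C_apply c x hk
      locNil := hloc }
  obtain ⟨eΛ⟩ := PlusDualTwo.nonempty_linearEquiv_iwasawaAlgebra_two W hss ha hκ v hv hg hpair ι h0 hsucc hsurj hker hequiv
  -- ### the dictionary relation `R n s x`: `x ∈ H¹(U_n, E[2^J]|)` is a witnessed class with point `s`
  let R : (n : ℕ) → S → continuousCohomology 1 (subgroupRep (LayerPairing.torsionLocalRep W (2 ^ J) v) (LayerPairing.layerGroup κ v n)) →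
      Prop := fun n s x ↦
    ∃ (f : contOneCocycles (subgroupRep (LayerPairing.torsionLocalRep W (2 ^ J) v) (LayerPairing.layerGroup κ v n))) (Q : Pt)
      (hQA : 2 ^ J • Q ∈ A), oneCocycleClass _ f = x ∧
      (∀ (τ : G) (hτ : τ ∈ localSubgroup κ.kerSubgroup (v.adicCompletion ℚ)),
        pointsMap W (v.adicCompletion ℚ) ((f.1 ⟨τ, TwistLayer.localSubgroup_le_layerGroup κ v n hτ⟩ : W.geomTorsion ((2 ^ J : ℕ) : ℤ)) :
          W.geomPoints) = τ • Q - Q) ∧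
      ι J ⟨2 ^ J • Q, hQA⟩ = s
  have Rfunc : ∀ n s x x', R n s x → R n s x' → x = x' := by
    rintro n s x x' ⟨f, Q, hQA, rfl, hf, hfs⟩ ⟨f', Q', hQ'A, rfl, hf', hf's⟩
    exact oneCocycleClass_eq_of_point_eq W hss κ J n v hv ι h0 hsucc hker hequiv f f' Q Q' hQA hQ'A hf hf' (hfs.trans hf's.symm)
  have Rsurj : ∀ n s, (2 ^ J • s = 0 ∧ (φ ^ 2 ^ n) s = s) → ∃ x, R n s x := by
    intro n s hs
    obtain ⟨f, Q, hQA, hf, hfs⟩ := exists_witness_of_mem_layer W κ J n v hg ι h0 hsucc hker hequiv hsurj hs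
    exact ⟨_, f, Q, hQA, rfl, hf, hfs⟩
  have Rmem : ∀ n s x, R n s x → 2 ^ J • s = 0 ∧ (φ ^ 2 ^ n) s = s := by
    rintro n s x ⟨f, Q, hQA, rfl, hf, rfl⟩
    exact point_mem_layer_of_witness W hss κ J n v hv hg ι h0 hsucc hker hequiv f Q hQA hf
  have Radd : ∀ n s s' x x', R n s x → R n s' x' → R n (s + s') (x + x') := by
    rintro n s s' x x' ⟨f, Q, hQA, rfl, hf, rfl⟩ ⟨f', Q', hQ'A, rfl, hf', rfl⟩
    refine ⟨f + f', Q + Q', by rw [smul_add]; exact A.add_mem hQA hQ'A, oneCocycleClass_add _ f f',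
      add_layerWitness W κ J n v f f' Q Q' hf hf', ?_⟩
    rw [← map_add]
    congr 1
    exact Subtype.ext (smul_add (2 ^ J) Q Q')
  have Rconj : ∀ n s x, R n s x → R n (φ s) (LayerPairing.layerConj W (2 ^ J) κ v n g x) := by
    rintro n s x ⟨f, Q, hQA, rfl, hf, rfl⟩
    obtain ⟨F, hF, hFwit⟩ := LayerClassPairing.exists_layerConj_cocycle_of_layerWitness W (2 ^ J) κ v n g f Q hf
    refine ⟨F, g • Q, ?_, hF, hFwit, ?_⟩
    · have e1 : 2 ^ J • (g • Q) = g • (2 ^ J • Q) := (map_nsmul (DistribSMul.toAddMonoidHom Pt g) (2 ^ J) Q).symm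
      rw [e1]; exact hγA _ hQA
    · exact point_smul_eq W κ J v ι h0 hsucc hker hequiv Q hQA
  have Rres : ∀ n s x, R n s x →
      R (n + 1) s (resLe (LayerPairing.torsionLocalRep W (2 ^ J) v) (LayerPairing.layerGroup_antitone κ v n) 1 x) := by
    rintro n s x ⟨f, Q, hQA, rfl, hf, rfl⟩
    obtain ⟨F, hF, hFwit⟩ := LayerClassPairing.exists_resLe_cocycle_of_layerWitness W (2 ^ J) κ v n f Q hf
    exact ⟨F, Q, hQA, hF, hFwit, rfl⟩
  have Rnorm : ∀ n s x, R (n + 1) s x →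
      ∀ [Fintype (LayerPairing.layerGroup κ v n ⧸ (LayerPairing.layerGroup κ v (n + 1)).subgroupOf (LayerPairing.layerGroup κ v n))],
      R n (s + (φ ^ 2 ^ n) s)
        (coresLe (LayerPairing.torsionLocalRep W (2 ^ J) v) (LayerPairing.layerGroup_antitone κ v n)
          (LayerPairing.isOpen_layerGroup κ v (n + 1)) x) := by
    rintro n s x ⟨f, Q, hQA, rfl, hf, rfl⟩ _
    obtain ⟨F, Q', hQ'A, hF, hFwit, hpt⟩ := exists_coresLe_witness_point W hss κ J n v hv hg ι h0 hsucc hker hequiv f Q hQA hf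
    exact ⟨F, Q', hQ'A, hF, hFwit, hpt⟩
  have Rhonest : ∀ m s, s ∈ (⇑(Polynomial.aeval (φ - 1) (cyclotomicOmegaMinus 2 (2 * m)))) ''
        {s : S | 2 ^ J • s = 0 ∧ Polynomial.aeval (φ - 1) (cyclotomicOmega 2 (2 * m)) s = 0} →
      ∃ P : localLayerPointsOfEmb κ ι₀ W (2 * m), R (2 * m) s (LayerPairing.layerKummer W (2 ^ J) κ v (2 * m) P) := by
    intro m s hs
    obtain ⟨P, f, Q, hQA, hf, hwit, hpt⟩ :=
      exists_honest_witness W hss ha hκ J m v hv hg ι h0 hsucc hker hequiv hsurj hpair hs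
    exact ⟨P, f, Q, hQA, hf, hwit, hpt⟩
  -- ### the classes `cls n s` and the pairings `B_n`
  let cls : (n : ℕ) → S → continuousCohomology 1 (subgroupRep (LayerPairing.torsionLocalRep W (2 ^ J) v) (LayerPairing.layerGroup κ v n)) :=
    fun n s ↦ if hx : ∃ x, R n s x then hx.choose else 0
  have hcls : ∀ n s x, R n s x → cls n s = x := by
    intro n s x hx
    have hex : ∃ x, R n s x := ⟨x, hx⟩
    have h1 : cls n s = hex.choose := dif_pos hex
    rw [h1]
    exact Rfunc n s _ _ hex.choose_spec hx
  let B : ℕ → S → S → ZMod (2 ^ J) := fun n s t ↦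
    LayerPairing.invAt (2 ^ J) v ((LayerPairing.layerSumPairing W (2 ^ J) e hμ hadd₁ hadd₂ hgal κ v n).cupProduct
      (LayerPairing.layerShapiro W (2 ^ J) κ v n (cls n s)) (LayerPairing.layerShapiro W (2 ^ J) κ v n (cls n t)))
  have hB : ∀ n s t x y, R n s x → R n t y → B n s t =
      LayerPairing.invAt (2 ^ J) v ((LayerPairing.layerSumPairing W (2 ^ J) e hμ hadd₁ hadd₂ hgal κ v n).cupProduct
        (LayerPairing.layerShapiro W (2 ^ J) κ v n x) (LayerPairing.layerShapiro W (2 ^ J) κ v n y)) := by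
    intro n s t x y hx hy
    change LayerPairing.invAt (2 ^ J) v ((LayerPairing.layerSumPairing W (2 ^ J) e hμ hadd₁ hadd₂ hgal κ v n).cupProduct
      (LayerPairing.layerShapiro W (2 ^ J) κ v n (cls n s)) (LayerPairing.layerShapiro W (2 ^ J) κ v n (cls n t))) = _
    rw [hcls n s x hx, hcls n t y hy]
  -- the layer condition of the extraction theorem is the layer `S[2^J, φ^{2^n} = 1]`
  have hL : ∀ n s, (2 ^ J • s = 0 ∧ Polynomial.aeval (φ - 1) (cyclotomicOmega 2 n) s = 0) ↔
      (2 ^ J • s = 0 ∧ (φ ^ 2 ^ n) s = s) := by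
    intro n s
    rw [aeval_cyclotomicOmega_two_apply, sub_eq_zero]
  -- ### the five identities
  have hadd₁B : ∀ n s₁ s₂ t, (2 ^ J • s₁ = 0 ∧ Polynomial.aeval (φ - 1) (cyclotomicOmega 2 n) s₁ = 0) →
      (2 ^ J • s₂ = 0 ∧ Polynomial.aeval (φ - 1) (cyclotomicOmega 2 n) s₂ = 0) →
      (2 ^ J • t = 0 ∧ Polynomial.aeval (φ - 1) (cyclotomicOmega 2 n) t = 0) →
      B n (s₁ + s₂) t = B n s₁ t + B n s₂ t := by
    intro n s₁ s₂ t hs₁ hs₂ ht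
    obtain ⟨x₁, hx₁⟩ := Rsurj n s₁ ((hL n s₁).1 hs₁)
    obtain ⟨x₂, hx₂⟩ := Rsurj n s₂ ((hL n s₂).1 hs₂)
    obtain ⟨y, hy⟩ := Rsurj n t ((hL n t).1 ht)
    rw [hB n _ _ _ _ (Radd n _ _ _ _ hx₁ hx₂) hy, hB n _ _ _ _ hx₁ hy, hB n _ _ _ _ hx₂ hy, map_add, map_add,
      LinearMap.add_apply, map_add]
  have hadd₂B : ∀ n s t₁ t₂, (2 ^ J • s = 0 ∧ Polynomial.aeval (φ - 1) (cyclotomicOmega 2 n) s = 0) →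
      (2 ^ J • t₁ = 0 ∧ Polynomial.aeval (φ - 1) (cyclotomicOmega 2 n) t₁ = 0) →
      (2 ^ J • t₂ = 0 ∧ Polynomial.aeval (φ - 1) (cyclotomicOmega 2 n) t₂ = 0) →
      B n s (t₁ + t₂) = B n s t₁ + B n s t₂ := by
    intro n s t₁ t₂ hs ht₁ ht₂
    obtain ⟨x, hx⟩ := Rsurj n s ((hL n s).1 hs)
    obtain ⟨y₁, hy₁⟩ := Rsurj n t₁ ((hL n t₁).1 ht₁)
    obtain ⟨y₂, hy₂⟩ := Rsurj n t₂ ((hL n t₂).1 ht₂)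
    rw [hB n _ _ _ _ hx (Radd n _ _ _ _ hy₁ hy₂), hB n _ _ _ _ hx hy₁, hB n _ _ _ _ hx hy₂, map_add, map_add, map_add]
  have hinvB : ∀ n s t, (2 ^ J • s = 0 ∧ Polynomial.aeval (φ - 1) (cyclotomicOmega 2 n) s = 0) →
      (2 ^ J • t = 0 ∧ Polynomial.aeval (φ - 1) (cyclotomicOmega 2 n) t = 0) →
      B n (φ s) (φ t) = B n s t := by
    intro n s t hs ht
    obtain ⟨x, hx⟩ := Rsurj n s ((hL n s).1 hs)
    obtain ⟨y, hy⟩ := Rsurj n t ((hL n t).1 ht)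
    rw [hB n _ _ _ _ (Rconj n _ _ hx) (Rconj n _ _ hy), hB n _ _ _ _ hx hy,
      LayerClassPairing.invAt_cupProduct_layerShapiro_layerConj]
  have hnormB : ∀ n s t, (2 ^ J • s = 0 ∧ Polynomial.aeval (φ - 1) (cyclotomicOmega 2 (n + 1)) s = 0) →
      (2 ^ J • t = 0 ∧ Polynomial.aeval (φ - 1) (cyclotomicOmega 2 n) t = 0) →
      B n (s + (φ ^ 2 ^ n) s) t = B (n + 1) s t := by
    intro n s t hs ht
    haveI : (LayerPairing.layerGroup κ v (n + 1)).FiniteIndex :=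
      finiteIndex_of_isOpen_of_compactSpace _ (LayerPairing.isOpen_layerGroup κ v (n + 1))
    haveI : Fintype (LayerPairing.layerGroup κ v n ⧸ (LayerPairing.layerGroup κ v (n + 1)).subgroupOf (LayerPairing.layerGroup κ v n)) :=
      Fintype.ofFinite _
    obtain ⟨x, hx⟩ := Rsurj (n + 1) s ((hL (n + 1) s).1 hs)
    obtain ⟨y, hy⟩ := Rsurj n t ((hL n t).1 ht)
    rw [hB n _ _ _ _ (Rnorm n s x hx) hy, hB (n + 1) _ _ _ _ hx (Rres n t y hy),
      LayerClassPairing.invAt_cupProduct_layerShapiro_coresLe]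
  have hVB : ∀ k s t, (2 ^ J • s = 0 ∧ Polynomial.aeval (φ - 1) (cyclotomicOmega 2 (2 * k)) s = 0) →
      (2 ^ J • t = 0 ∧ Polynomial.aeval (φ - 1) (cyclotomicOmega 2 (2 * k)) t = 0) →
      B (2 * k) (Polynomial.aeval (φ - 1) (cyclotomicOmegaMinus 2 (2 * k)) s)
        (Polynomial.aeval (φ - 1) (cyclotomicOmegaMinus 2 (2 * k)) t) = 0 := by
    intro k s t hs ht
    obtain ⟨P, hP⟩ := Rhonest k _ (Set.mem_image_of_mem _ hs)
    obtain ⟨P', hP'⟩ := Rhonest k _ (Set.mem_image_of_mem _ ht)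
    rw [hB (2 * k) _ _ _ _ hP hP', LayerKummerIso.cupProduct_layerShapiro_layerKummer_eq_zero W (2 ^ J) e hμ hadd₁ hadd₂ hgal κ v halt,
      map_zero]
  -- ### the θ-extraction: `B_n = 0` on every layer
  have hzero := ResidualThetaLayer.PlusDual.forall_layerForm_eq_zero_two hpair eΛ J B hadd₁B hadd₂B hinvB hnormB hVB
  -- ### conclusion for the given witnessed classes at layer `J`
  have hQfA : 2 ^ J • Qf ∈ A := nsmul_mem_of_layerWitness W hss κ J J v hv f₀ Qf hkQf hf₀
  have hQgA : 2 ^ J • Qg ∈ A := nsmul_mem_of_layerWitness W hss κ J J v hv g₀ Qg hkQg hg₀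
  have hRf : R J (ι J ⟨2 ^ J • Qf, hQfA⟩) (oneCocycleClass _ f₀) := ⟨f₀, Qf, hQfA, rfl, hf₀, rfl⟩
  have hRg : R J (ι J ⟨2 ^ J • Qg, hQgA⟩) (oneCocycleClass _ g₀) := ⟨g₀, Qg, hQgA, rfl, hg₀, rfl⟩
  have h0B := hzero J _ _ ((hL J _).2 (Rmem J _ _ hRf)) ((hL J _).2 (Rmem J _ _ hRg))
  rw [hB J _ _ _ _ hRf hRg] at h0B
  exact invAt_injective (2 ^ J) v (h0B.trans (map_zero _).symm)

end Summit.BirchSwinnertonDyer.BirchSwinnertonDyer.Theorems.SignedEC.LayerIsoAssembly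

end
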